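import Summits.ValiantsHypothesis.ValiantsHypothesis.Theorems.BarrierLeverPartitionMinorsHitByVPExactCoverNoGoCurves

/-!
# Route BarrierLever — item `PartitionMinorsHitByVP` (stmt-ValiantsHypothesis-19717):
# exact-cover certificates, part 3/3 — THE EXACT-COVER DOOR CANNOT BE OPENED

Link file (`--supports stmt-ValiantsHypothesis-19717`; cell valiant-natproofs, rung V4, 𝒟-side door (c);
prover seat val-np-p1 gen 14). Definition-free. Closes NO item; it closes a DOOR: the hypothesis of
`ExactCoverDoor.partitionMinorsHitByVP_of_bricks_lowerSets` (p556909, seat g13) — «for every `h ≥ 2` and every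
injective lower-set layout some list of `≤ (h+h)³` weighted bricks `1 + ε x^Z y^W` has a nonsingular layout matrix»
— is FALSE (`not_exactCoverHypothesis_lowerSets`), and so is the stronger all-layouts hypothesis of
`ExactCoverDoor.partitionMinorsHitByVP_of_bricks` (`not_exactCoverHypothesis`). In words: g13's EXACT-COVER
CONJECTURE (poly-size cancellation-free monomial certificates for every lower pair) is false; item 19717 itself is
untouched (its witnesses need not be brick products), as are the exp-doors whose logarithm has exponentially many
monomials (sequential door p554023, bi-additive door p544685, the anchored door of the seat memo).

**The counterexample (`h = 127² = 16129`).** Rows: the union `R₀` of the cubes `2^{S_c}` over the `127⁷` graphs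
`S_c ⊆ 𝔽₁₂₇²` of the polynomials of degree `< 7` over `𝔽₁₂₇` (part 2: `|S_c| = 127`, two graphs share `< 7` points,
`R₀` lower, `|R₀| ≤ 127⁷·2¹²⁷`); columns: a lower family of the same size made of sets of size `≤ 21`
(`exists_lower_family_card_eq`, a prefix of the Hamming ball; `127⁷·2¹²⁷ ≤ C(16129, 21)`). If a brick list certified
this layout then, after stripping pure bricks (part 1, unipotent row/column operations on lower families), a
transversal of nonzero entries gives for every graph `S_c` a cover by `≤ 21` mixed bricks with pairwise disjoint
`y`-parts inside a column of size `≤ 21`, whose `x`-parts lie in `S_c` and cover it; as `21·6 < 127` one of them has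
`≥ 7` points, hence lies on NO other graph: `c ↦` that brick is injective, so the list has `≥ 127⁷ > (2h)³` bricks.
(Asymptotically the same construction with `d ≈ ½ log₂ q` forces `2^{Ω(log² h)}` bricks: no polynomial bound at all;
seat memo HOME/val-np-p1/g14/ANCHORED-MEMO-valnp1-g14.md §1.)

WHAT THIS IS NOT: not a statement about item 19717 or about `SmallCircuits`; nothing on crux stmt-ValiantsHypothesis-14610
or `VP` versus `VNP`.
-/

set_option linter.dupNamespace false

namespace Summit.ValiantsHypothesis.ValiantsHypothesis.Theorems.BarrierLever.ExactCoverNoGo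

open Finset MvPolynomial
open Summit.ValiantsHypothesis.ValiantsHypothesis.Theorems.BarrierLever.BrickCalculus

noncomputable section

/-! ## 1. A lower family of prescribed size inside a Hamming ball -/

/-- For `1 ≤ N ≤ |{T ⊆ Fin h : |T| ≤ K}|` there is a lower family of exactly `N` subsets of `Fin h`, all of size `≤ K`
(a Hamming ball plus part of the next layer). -/
theorem exists_lower_family_card_eq (h K N : ℕ) (h1 : 1 ≤ N)
    (hN : N ≤ ((Finset.univ : Finset (Finset (Fin h))).filter (fun T => T.card ≤ K)).card) :
    ∃ C : Finset (Finset (Fin h)), C.card = N ∧ IsLowerSet (↑C : Set (Finset (Fin h))) ∧ ∀ T ∈ C, T.card ≤ K := by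
  classical
  let ball : ℕ → Finset (Finset (Fin h)) := fun j => Finset.univ.filter (fun T => T.card ≤ j)
  have hball_lower : ∀ j, IsLowerSet (↑(ball j) : Set (Finset (Fin h))) := by
    intro j T T' hT'T hT
    rw [Finset.mem_coe, Finset.mem_filter] at hT ⊢
    exact ⟨Finset.mem_univ _, (Finset.card_le_card hT'T).trans hT.2⟩
  have hex : ∃ j, N ≤ (ball j).card := ⟨K, hN⟩
  obtain ⟨j₀, hj₀def⟩ : ∃ j₀, j₀ = Nat.find hex := ⟨_, rfl⟩
  have hj₀ : N ≤ (ball j₀).card := hj₀def ▸ Nat.find_spec hex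
  have hj₀K : j₀ ≤ K := hj₀def ▸ Nat.find_min' hex hN
  have hmin : ∀ j, j < j₀ → ¬ N ≤ (ball j).card := fun j hj => by
    rw [hj₀def] at hj; exact Nat.find_min hex hj
  rcases Nat.eq_zero_or_pos j₀ with hz | hpos
  · -- `N = 1`: the family `{∅}`
    have hb0 : ball 0 = {∅} := by
      ext T; simp only [ball, Finset.mem_filter, Finset.mem_univ, true_and, Nat.le_zero, Finset.card_eq_zero,
        Finset.mem_singleton]
    rw [hz, hb0, Finset.card_singleton] at hj₀
    refine ⟨{∅}, by rw [Finset.card_singleton]; omega, ?_, fun T hT => by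
      rw [Finset.mem_singleton.mp hT, Finset.card_empty]; exact Nat.zero_le _⟩
    intro T T' hT'T hT
    rw [Finset.mem_coe, Finset.mem_singleton] at hT ⊢
    rw [hT] at hT'T
    exact Finset.subset_empty.mp hT'T
  · obtain ⟨j, hj⟩ : ∃ j, j₀ = j + 1 := ⟨j₀ - 1, by omega⟩
    have hlt : (ball j).card < N := not_le.mp (hmin j (by omega))
    -- the next layer
    let layer : Finset (Finset (Fin h)) := Finset.univ.filter (fun T => T.card = j + 1)
    have hsplit : ball (j + 1) = ball j ∪ layer := by
      ext T
      simp only [ball, layer, Finset.mem_filter, Finset.mem_univ, true_and, Finset.mem_union]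
      omega
    have hdisj : Disjoint (ball j) layer := by
      rw [Finset.disjoint_left]
      intro T hT hT'
      simp only [ball, layer, Finset.mem_filter, Finset.mem_univ, true_and] at hT hT'
      omega
    have hcard : (ball (j + 1)).card = (ball j).card + layer.card := by
      rw [hsplit, Finset.card_union_of_disjoint hdisj]
    rw [hj] at hj₀ hj₀K
    obtain ⟨t, ht, htcard⟩ := Finset.exists_subset_card_eq (s := layer) (n := N - (ball j).card) (by omega)
    refine ⟨ball j ∪ t, ?_, ?_, ?_⟩
    · rw [Finset.card_union_of_disjoint (hdisj.mono_right ht), htcard]; omega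
    · intro T T' hT'T hT
      rw [Finset.mem_coe, Finset.mem_union] at hT ⊢
      rcases hT with hT | hT
      · exact Or.inl (hball_lower j hT'T hT)
      · by_cases heq : T' = T
        · exact Or.inr (heq ▸ hT)
        · left
          have hT1 : T.card = j + 1 := by
            have := ht hT; simp only [layer, Finset.mem_filter] at this; exact this.2
          have hss : T' ⊂ T := lt_of_le_of_ne hT'T heq
          simp only [ball, Finset.mem_filter, Finset.mem_univ, true_and]
          have := Finset.card_lt_card hss; omega
    · intro T hT
      rcases Finset.mem_union.mp hT with hT | hT
      · simp only [ball, Finset.mem_filter] at hT; omega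
      · have := ht hT; simp only [layer, Finset.mem_filter] at this; omega

/-- Enumerating a finset of prescribed size. -/
theorem exists_enum {α : Type*} (s : Finset α) {r : ℕ} (hr : s.card = r) :
    ∃ u : Fin r → α, Function.Injective u ∧ Set.range u = ↑s := by
  classical
  subst hr
  let uE : ↥s ≃ Fin s.card := Fintype.equivFinOfCardEq (Fintype.card_coe _)
  refine ⟨fun i => (uE.symm i).1, fun i i' hii' => uE.symm.injective (Subtype.ext hii'), ?_⟩
  ext x; constructor
  · rintro ⟨i, rfl⟩; exact (uE.symm i).2
  · intro hx; exact ⟨uE ⟨x, hx⟩, by simp only [Equiv.symm_apply_apply]⟩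

/-- **What a certificate forces on one row.** On an injective lower-set layout whose columns have size `≤ K`, if a
weighted brick list has nonsingular layout matrix then every row `u i` with `K·d < |u i|` contains the `x`-part of some
brick of the list of size `> d`. (Strip pure bricks; take a transversal; the row is covered by the `x`-parts of `≤ K`
mixed bricks whose `y`-parts are disjoint inside a column.) -/
theorem exists_big_part {n r K L : ℕ} (u w : Fin r → Finset (Fin n)) (hu : Function.Injective u)
    (hul : IsLowerSet (Set.range u)) (hw : Function.Injective w) (hwl : IsLowerSet (Set.range w))
    (hK : ∀ j, (w j).card ≤ K) (ε : Fin L → ℂ) (Z W : Fin L → Finset (Fin n))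
    (hdet : (Matrix.of fun i j : Fin r => coeff (pexpo (u i) (w j))
      (∏ l : Fin L, (1 + C (ε l) * (∏ a ∈ Z l, X (Fin.castAdd n a)) * (∏ c ∈ W l, X (Fin.natAdd n c))) :
        MvPolynomial (Fin (n + n)) ℂ)).det ≠ 0)
    (i : Fin r) (d : ℕ) (hd : K * d < (u i).card) : ∃ l : Fin L, Z l ⊆ u i ∧ d < (Z l).card := by
  classical
  have hdet' := det_layout_mixed_ne_zero u w hu hul hw hwl ε Z W hdet
  obtain ⟨σ, hσ⟩ := exists_perm_of_det_ne_zero _ hdet'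
  have hne := hσ (σ.symm i)
  rw [Equiv.apply_symm_apply, Matrix.of_apply] at hne
  obtain ⟨I, hI, hZW, hcov, hdis⟩ := exists_cover_of_coeff_ne_zero ε Z W _ _ _ hne
  -- at most `K` bricks: disjoint nonempty `y`-parts inside a column of size `≤ K`
  have hIcard : I.card ≤ K := by
    have hpd : (↑I : Set (Fin L)).PairwiseDisjoint W := fun l hl l' hl' hne' => hdis l hl l' hl' hne'
    calc I.card = ∑ _l ∈ I, 1 := by rw [Finset.card_eq_sum_ones]
      _ ≤ ∑ l ∈ I, (W l).card := Finset.sum_le_sum (fun l hl => Finset.card_pos.mpr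
          ((Finset.mem_filter.mp (hI hl)).2.2))
      _ = (I.biUnion W).card := (Finset.card_biUnion hpd).symm
      _ ≤ (w (σ.symm i)).card := Finset.card_le_card (Finset.biUnion_subset.mpr (fun l hl => (hZW l hl).2))
      _ ≤ K := hK _
  by_contra hno
  simp only [not_exists, not_and, not_lt] at hno
  have hsmall : ∀ l ∈ I, (Z l).card ≤ d := fun l hl => hno l (hZW l hl).1
  have : (u i).card ≤ K * d :=
    calc (u i).card ≤ (I.biUnion Z).card := Finset.card_le_card hcov
      _ ≤ ∑ l ∈ I, (Z l).card := Finset.card_biUnion_le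
      _ ≤ ∑ _l ∈ I, d := Finset.sum_le_sum hsmall
      _ = I.card * d := by rw [Finset.sum_const, smul_eq_mul]
      _ ≤ K * d := by gcongr
  omega

/-! ## 2. The no-go -/

/-- **The counting core (any finite field).** Let `F` be a finite field with `q` elements, `e : F × F ≃ Fin n`,
`d ≥ 1`, `K (d−1) < q`, and suppose the ball `{T ⊆ Fin n : |T| ≤ K}` has at least `q^d 2^q` elements. If the
exact-cover hypothesis holds AT HEIGHT `n` (for all injective lower-set layouts), then `q^d ≤ (n+n)³`: the
Reed–Solomon layout forces `q^d` distinct bricks. -/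
theorem card_pow_le_of_exactCoverHypothesisAt {F : Type*} [Field F] [Fintype F] {n d K : ℕ}
    (e : F × F ≃ Fin n) (hd : 1 ≤ d) (hKd : K * (d - 1) < Fintype.card F)
    (hballK : Fintype.card F ^ d * 2 ^ Fintype.card F ≤
      ((Finset.univ : Finset (Finset (Fin n))).filter (fun T => T.card ≤ K)).card)
    (hypn : ∀ (r : ℕ) (u w : Fin r → Finset (Fin n)),
      Function.Injective u → Function.Injective w →
      IsLowerSet (Set.range u) → IsLowerSet (Set.range w) →
      ∃ (L : ℕ) (_ : L ≤ (n + n) ^ 3) (ε : Fin L → ℂ) (Z W : Fin L → Finset (Fin n)),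
        (Matrix.of fun i j : Fin r => MvPolynomial.coeff
          (∑ a ∈ u i, Finsupp.single (Fin.castAdd n a) 1 +
            ∑ c ∈ w j, Finsupp.single (Fin.natAdd n c) 1)
          (∏ i : Fin L, (1 + C (ε i) * (∏ a ∈ Z i, X (Fin.castAdd n a)) *
            (∏ c ∈ W i, X (Fin.natAdd n c))) : MvPolynomial (Fin (n + n)) ℂ)).det ≠ 0) :
    Fintype.card F ^ d ≤ (n + n) ^ 3 := by
  classical
  obtain ⟨c₀⟩ : Nonempty (Fin d → F) := ⟨fun _ => 0⟩
  -- rows and columns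
  have hR₀pos : 1 ≤ (rsFamily e d).card := one_le_card_rsFamily e ⟨c₀, trivial⟩
  have hR₀le : (rsFamily e d).card ≤ ((Finset.univ : Finset (Finset (Fin n))).filter (fun T => T.card ≤ K)).card :=
    (card_rsFamily_le e).trans hballK
  obtain ⟨Cc, hCcard, hClow, hCsmall⟩ := exists_lower_family_card_eq n K (rsFamily e d).card hR₀pos hR₀le
  obtain ⟨u, hu, hru⟩ := exists_enum (rsFamily e d) rfl
  obtain ⟨w, hw, hrw⟩ := exists_enum Cc hCcard
  have hul : IsLowerSet (Set.range u) := by rw [hru]; exact isLowerSet_rsFamily e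
  have hwl : IsLowerSet (Set.range w) := by rw [hrw]; exact hClow
  have hK : ∀ j, (w j).card ≤ K := fun j => hCsmall _ (by rw [← Finset.mem_coe, ← hrw]; exact ⟨j, rfl⟩)
  obtain ⟨L, hL, ε, Z, W, hdet⟩ := hypn (rsFamily e d).card u w hu hw hul hwl
  -- every graph owns a brick of the list with `≥ d` points on it
  have main : ∀ c : Fin d → F, ∃ l : Fin L, Z l ⊆ curve e c ∧ d - 1 < (Z l).card := by
    intro c
    obtain ⟨i, hi⟩ : curve e c ∈ Set.range u := by
      rw [hru]; exact Finset.mem_coe.mpr (curve_mem_rsFamily e c)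
    rw [← hi]
    refine exists_big_part u w hu hul hw hwl hK ε Z W hdet i (d - 1) ?_
    rw [hi, card_curve]; exact hKd
  choose g hg using main
  have ginj : Function.Injective g := by
    intro c c' hcc'
    by_contra hne
    have hlt := card_curve_inter_lt e hd c c' hne
    have hsub : Z (g c) ⊆ curve e c ∩ curve e c' :=
      Finset.subset_inter (hg c).1 (by rw [hcc']; exact (hg c').1)
    have := (hg c).2.trans_le (Finset.card_le_card hsub)
    omega
  have hcount := Fintype.card_le_of_injective g ginj
  rw [Fintype.card_fun, Fintype.card_fin, Fintype.card_fin] at hcount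
  exact hcount.trans hL

/-- **THE EXACT-COVER DOOR CANNOT BE OPENED (lower-set form).** The hypothesis of
`ExactCoverDoor.partitionMinorsHitByVP_of_bricks_lowerSets` is false: at `h = 16129 = 127²` the Reed–Solomon layout
«union of the cubes on the graphs of the degree-`< 7` polynomials over `𝔽₁₂₇`» versus «a ball prefix of the same size»
admits no list of `≤ (h+h)³` weighted bricks with nonsingular layout matrix (every such list has `≥ 127⁷` bricks). -/
theorem not_exactCoverHypothesis_lowerSets :
    ¬ (∀ h : ℕ, 2 ≤ h → ∀ (r : ℕ) (u w : Fin r → Finset (Fin h)),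
      Function.Injective u → Function.Injective w →
      IsLowerSet (Set.range u) → IsLowerSet (Set.range w) →
      ∃ (L : ℕ) (_ : L ≤ (h + h) ^ 3) (ε : Fin L → ℂ) (Z W : Fin L → Finset (Fin h)),
        (Matrix.of fun i j : Fin r => MvPolynomial.coeff
          (∑ a ∈ u i, Finsupp.single (Fin.castAdd h a) 1 +
            ∑ c ∈ w j, Finsupp.single (Fin.natAdd h c) 1)
          (∏ i : Fin L, (1 + C (ε i) * (∏ a ∈ Z i, X (Fin.castAdd h a)) *
            (∏ c ∈ W i, X (Fin.natAdd h c))) : MvPolynomial (Fin (h + h)) ℂ)).det ≠ 0) := by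
  classical
  intro hyp
  haveI : Fact (Nat.Prime 127) := ⟨by norm_num⟩
  have hF : Fintype.card (ZMod 127) = 127 := ZMod.card 127
  have hcard : Fintype.card (ZMod 127 × ZMod 127) = 16129 := by rw [Fintype.card_prod, hF]
  -- the ball `{T ⊆ Fin 16129 : |T| ≤ 21}` has at least `C(16129, 21) ≥ 127⁷ · 2¹²⁷` elements
  have hball : 127 ^ 7 * 2 ^ 127 ≤
      ((Finset.univ : Finset (Finset (Fin 16129))).filter (fun T => T.card ≤ 21)).card := by
    have h2 : 127 ^ 7 * 2 ^ 127 ≤ Nat.choose 16129 21 := by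
      have h3 : (16129 + 1 - 21) ^ 21 ≤ (16129 : ℕ).descFactorial 21 := Nat.pow_sub_le_descFactorial 16129 21
      rw [Nat.descFactorial_eq_factorial_mul_choose] at h3
      have h4 : Nat.factorial 21 * (127 ^ 7 * 2 ^ 127) ≤ (16129 + 1 - 21) ^ 21 := by
        rw [show Nat.factorial 21 = 51090942171709440000 by rfl]; norm_num
      exact Nat.le_of_mul_le_mul_left (h4.trans h3) (Nat.factorial_pos 21)
    have h3 : Nat.choose 16129 21 ≤ ((Finset.univ : Finset (Finset (Fin 16129))).filter (fun T => T.card ≤ 21)).card := by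
      calc Nat.choose 16129 21 = (Finset.powersetCard 21 (Finset.univ : Finset (Fin 16129))).card := by
            rw [Finset.card_powersetCard, Finset.card_univ, Fintype.card_fin]
        _ ≤ _ := by
            refine Finset.card_le_card (fun T hT => ?_)
            rw [Finset.mem_powersetCard] at hT
            exact Finset.mem_filter.mpr ⟨Finset.mem_univ _, hT.2.le⟩
    exact h2.trans h3
  have hcore := card_pow_le_of_exactCoverHypothesisAt (Fintype.equivFinOfCardEq hcard) (d := 7) (K := 21)
    (by norm_num) (by rw [hF]; norm_num) (by rw [hF]; exact hball) (hyp 16129 (by norm_num))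
  rw [hF] at hcore
  have hlt : (16129 + 16129) ^ 3 < 127 ^ 7 := by norm_num
  omega

/-- **THE EXACT-COVER DOOR CANNOT BE OPENED (all-layouts form).** The (stronger) hypothesis of
`ExactCoverDoor.partitionMinorsHitByVP_of_bricks` is false as well. -/
theorem not_exactCoverHypothesis :
    ¬ (∀ h : ℕ, 2 ≤ h → ∀ (r : ℕ) (u w : Fin r → Finset (Fin h)),
      Function.Injective u → Function.Injective w →
      ∃ (L : ℕ) (_ : L ≤ (h + h) ^ 3) (ε : Fin L → ℂ) (Z W : Fin L → Finset (Fin h)),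
        (Matrix.of fun i j : Fin r => MvPolynomial.coeff
          (∑ a ∈ u i, Finsupp.single (Fin.castAdd h a) 1 +
            ∑ c ∈ w j, Finsupp.single (Fin.natAdd h c) 1)
          (∏ i : Fin L, (1 + C (ε i) * (∏ a ∈ Z i, X (Fin.castAdd h a)) *
            (∏ c ∈ W i, X (Fin.natAdd h c))) : MvPolynomial (Fin (h + h)) ℂ)).det ≠ 0) :=
  fun hyp => not_exactCoverHypothesis_lowerSets (fun h hh r u w hu hw _ _ => hyp h hh r u w hu hw)

end

end Summit.ValiantsHypothesis.ValiantsHypothesis.Theorems.BarrierLever.ExactCoverNoGo
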